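import Mathlib
import Summits.ResolutionOfSingularities.ResolutionOfSingularities.Theorems.HomologicalConductorPersistenceSurfaceOfLocalCore
import Summits.ResolutionOfSingularities.ResolutionOfSingularities.Theorems.HomologicalConductorPersistenceFaithfullyFlatDescentCompletion
import Summits.ResolutionOfSingularities.ResolutionOfSingularities.Theorems.HomologicalConductorPersistenceCompletionAscentHolds
import Summits.ResolutionOfSingularities.ResolutionOfSingularities.Theorems.HomologicalConductorPersistenceCompletionIsolatedTransfer
import Summits.ResolutionOfSingularities.ResolutionOfSingularities.Theses.HomologicalConductor
import Summits.ResolutionOfSingularities.ResolutionOfSingularities.Theorems.HomologicalConductorPersistenceSurfaceFirstStep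
import Literature.AlgebraicGeometry.Resolution.RegularLocalRingsQuotient
import HarnessLib

/-!
# Rung S-2 `PersistenceSurface` (stmt-ResolutionOfSingularities-19970) — the rung from ONE COMPLETED MEMBERSHIP per step:
# the admissible parameter `x₀` of `ca(T_m)` lies in `ca(T̂_(m+1))`

Route `ResolutionOfSingularities/HomologicalConductor`, chain W4.4b, rung S-2 `PersistenceSurface`
(stmt-ResolutionOfSingularities-19970), registered skeleton 1a77c002 (stub `stub_localChartPersistenceSurface` = the local
surface core; transfer stubs `stub_completedStepPersistenceRationalNormal'`, `stub_levelFourPersistenceNonnormalOrNonrational'`).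
[OURS · bookkeeping over LANDED tree lemmas; AI-written, weaker than expert review; NOT a statement of the manuscript under
study (Hironaka 2017) and no statement of that manuscript is used.]  DEF-FREE; every premise is a hypothesis.

The local core asks, at every step `T_m → T_(m+1) = loc O (nrm (T_m[ca T_m / x₀]))`, for `x₀ ∈ ca(T_(m+1))` where `x₀` is an
ADMISSIBLE element of `ca(T_m)` (nonzero, of minimal `O`-value; `di_exists_admissible`); every `x ∈ ca(T_m)` is then
`(x·x₀⁻¹)·x₀` with `x·x₀⁻¹ ∈ T_(m+1)` (`ca_mul_inv_mem_tower_succ`).  Singularity theory knows the successor stage through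
its COMPLETE local ring.  Since `ca` DESCENDS from the completion level-free and unconditionally
(`comap_cohomologyAnnihilator_le_of_faithfullyFlat'` with `faithfullyFlat_adicCompletion`, [BHST 4.5 (1)], p512917 lineage),
the rung follows from ONE membership per step READ IN THE COMPLETION:

* `mem_ca_of_algebraMap_mem_cohomologyAnnihilator_completion` — for a stage `T` (noetherian local) and `x ∈ T`:
  `algebraMap x ∈ ca(T̂) ⇒ x ∈ ca T` (route vocabulary);
* `algebraMap_mem_cohomologyAnnihilator_completion_of_mem_ca` — the converse at a NORMAL stage of Krull dimension `≤ 2`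
  essentially of finite type over `k` (ascent [BHST 4.5 (2)], `le_caCompletion_comap_holds`, needs `T̂` an isolated
  singularity: `isIsolatedSingularity_of_isIntegrallyClosed_of_ringKrullDim_le_two` + `…_adicCompletion_of_essFiniteType`);
  so at the stages `T_(m+1)` (all normal) the completed membership is EQUIVALENT to the membership;
* **`persistenceSurface_of_completedAdmissibleMembership`** — the ROUTE DECL BY NAME from: «for every admissible surface
  datum, every `m` and every admissible `x₀ ∈ ca(T_m)`, the image of `x₀` in the `𝔪`-adic completion of `T_(m+1)` lies in
  `ca(T̂_(m+1))`»;
* `persistenceSurface_iff_completedAdmissibleMembership` — and conversely (the stages `T_(m+1)` are normal of dimension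
  `≤ 2`: `d2rc_isIntegrallyClosed_tower_succ`, `ringKrullDim_tower_le_of_ringKrullDim_le`), so this is an EXACT restatement
  of the rung, one analytic membership per step.

References: A. Bahlekeh, E. Hakimian, S. Salarian, R. Takahashi, Q. J. Math. 67 (2016), Thm. 4.5
[`BahlekehHakimianSalarianTakahashi2015`]; S. B. Iyengar, R. Takahashi, IMRN 2016, Def. 2.1 [`IyengarTakahashi2014`].
-/

noncomputable section

-- single-problem summit: the doubled namespace component `ResolutionOfSingularities` is forced
set_option linter.dupNamespace false

namespace Summit.ResolutionOfSingularities.ResolutionOfSingularities.Theorems.HomologicalConductor.PersistenceSurfaceCompletedAdmissibleMembership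

open IsLocalRing
open Literature.RingTheory.CohomologyAnnihilator
  (cohomologyAnnihilator mem_cohomologyAnnihilator_iff IsIsolatedSingularity
    isIsolatedSingularity_of_isIntegrallyClosed_of_ringKrullDim_le_two)
open Literature.AlgebraicGeometry.Resolution (isFractionRing_subalgebra_of_le exists_nat_cast_eq_ringKrullDim)
open Summit.ResolutionOfSingularities.ResolutionOfSingularities.Theses.HomologicalConductor (PersistenceSurface)
open Summit.ResolutionOfSingularities.ResolutionOfSingularities.Theorems
open Summit.ResolutionOfSingularities.ResolutionOfSingularities.Theorems.NoZeno.Birth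
open Summit.ResolutionOfSingularities.ResolutionOfSingularities.Theorems.HomologicalConductor (PersistenceSurfaceFirstStep.persistenceSurface_iff_firstStep)
open Summit.ResolutionOfSingularities.ResolutionOfSingularities.Theorems.HomologicalConductor.PersistenceRadical (ca_eq_image)
open Summit.ResolutionOfSingularities.ResolutionOfSingularities.Theorems.HomologicalConductor.PersistenceSurfaceTowerDim
  (ringKrullDim_tower_le_of_ringKrullDim_le)
open Summit.ResolutionOfSingularities.ResolutionOfSingularities.Theorems.HomologicalConductor.PersistenceSurfaceOfLocalCore
  (tower_isLocalRing_and_dominated)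
open Summit.ResolutionOfSingularities.ResolutionOfSingularities.Theorems.HomologicalConductor.PersistenceFaithfullyFlatDescentCompletion
  (comap_cohomologyAnnihilator_le_of_faithfullyFlat' faithfullyFlat_adicCompletion)
open Summit.ResolutionOfSingularities.ResolutionOfSingularities.Theorems.HomologicalConductor.CompletionAscentHolds
  (le_caCompletion_comap_holds)
open Summit.ResolutionOfSingularities.ResolutionOfSingularities.Theorems.HomologicalConductor.CompletionIsolatedTransfer
  (isIsolatedSingularity_adicCompletion_of_essFiniteType)

variable {k K : Type} [Field k] [Field K] [Algebra k K]

/-! ## One stage: membership in `ca` read in the completion -/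

/-- **Descent of one membership.**  For a noetherian local stage `T ⊆ K` and `x ∈ T`: if the image of `x` in the `𝔪`-adic
completion `T̂` lies in `ca(T̂)`, then `x ∈ ca T` (route vocabulary) — `ca(T̂) ∩ T ⊆ ca(T)` along the faithfully flat
`T → T̂` [BHST 4.5 (1)], unconditionally. [cite: BahlekehHakimianSalarianTakahashi2015, Thm. 4.5 (1)] -/
theorem mem_ca_of_algebraMap_mem_cohomologyAnnihilator_completion (T : Subalgebra k K) [IsNoetherianRing ↥T]
    [IsLocalRing ↥T] {x : K} (hxT : x ∈ T)
    (hx : algebraMap ↥T (AdicCompletion (maximalIdeal ↥T) ↥T) ⟨x, hxT⟩ ∈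
      cohomologyAnnihilator (AdicCompletion (maximalIdeal ↥T) ↥T)) :
    x ∈ ca T := by
  haveI := faithfullyFlat_adicCompletion ↥T
  have h : (⟨x, hxT⟩ : ↥T) ∈ cohomologyAnnihilator ↥T :=
    comap_cohomologyAnnihilator_le_of_faithfullyFlat' (S := AdicCompletion (maximalIdeal ↥T) ↥T)
      (Ideal.mem_comap.mpr hx)
  rw [ca_eq_image T]
  exact ⟨⟨x, hxT⟩, h, rfl⟩

/-- **Ascent of one membership at a normal surface stage.**  For a normal local stage `T ⊆ K`, essentially of finite type
over `k`, of Krull dimension `≤ 2`, and `x ∈ ca T`: the image of `x` lies in `ca(T̂)` — `T` and `T̂` are isolated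
singularities (`isIsolatedSingularity_of_isIntegrallyClosed_of_ringKrullDim_le_two`,
`isIsolatedSingularity_adicCompletion_of_essFiniteType`) and `caⁿ(T) ⊆ caⁿ⁺ᵈ(T̂) ∩ T` [BHST 4.5 (2)].
[cite: BahlekehHakimianSalarianTakahashi2015, Thm. 4.5 (2)] -/
theorem algebraMap_mem_cohomologyAnnihilator_completion_of_mem_ca (T : Subalgebra k K) [IsNoetherianRing ↥T]
    [IsLocalRing ↥T] [IsIntegrallyClosed ↥T] (hT : Algebra.EssFiniteType k ↥T) (hdim : ringKrullDim ↥T ≤ 2)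
    {x : K} (hx : x ∈ ca T) :
    algebraMap ↥T (AdicCompletion (maximalIdeal ↥T) ↥T) ⟨x, ca_subset T hx⟩ ∈
      cohomologyAnnihilator (AdicCompletion (maximalIdeal ↥T) ↥T) := by
  obtain ⟨d, hd⟩ := exists_nat_cast_eq_ringKrullDim (R := ↥T)
  have hisoT : IsIsolatedSingularity ↥T :=
    isIsolatedSingularity_of_isIntegrallyClosed_of_ringKrullDim_le_two (R := ↥T) hdim
  have hiso := isIsolatedSingularity_adicCompletion_of_essFiniteType k hT hisoT
  have hx' : (⟨x, ca_subset T hx⟩ : ↥T) ∈ cohomologyAnnihilator ↥T := by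
    have h := hx
    rw [ca_eq_image T] at h
    obtain ⟨y, hy, hyx⟩ := h
    have : y = ⟨x, ca_subset T hx⟩ := Subtype.ext hyx
    rw [← this]; exact hy
  obtain ⟨n, hn⟩ := mem_cohomologyAnnihilator_iff.mp hx'
  have h := le_caCompletion_comap_holds ↥T d hd hiso n hn
  rw [Ideal.mem_comap] at h
  exact mem_cohomologyAnnihilator_iff.mpr ⟨n + d, h⟩

/-! ## The rung from one completed membership per step -/

/-- **`PersistenceSurface` (the route decl, by name) from ONE COMPLETED MEMBERSHIP per step.**  Hypothesis: for every
admissible surface datum `(A, O)`, every `m` and every admissible `x₀ ∈ ca(T_m)` (nonzero, `c·x₀⁻¹ ∈ O` for all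
`c ∈ ca(T_m)`), the image of `x₀` in the `𝔪`-adic completion of `T_(m+1)` lies in `ca(T̂_(m+1))`.  Then every
`x ∈ ca(T_m)` is `(x·x₀⁻¹)·x₀ ∈ ca(T_(m+1))` (`di_exists_admissible`, `ca_mul_inv_mem_tower_succ`, `mul_mem_ca`, and the
descent `mem_ca_of_algebraMap_mem_cohomologyAnnihilator_completion`).
[cite: BahlekehHakimianSalarianTakahashi2015, Thm. 4.5 (1); IyengarTakahashi2014, Def. 2.1] -/
theorem persistenceSurface_of_completedAdmissibleMembership
    (h : ∀ p : ℕ, p.Prime → ∀ (k K : Type) [Field k] [CharP k p] [Field K] [Algebra k K]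
      (O : ValuationSubring K) (A : Subalgebra k K), (∀ c : k, algebraMap k K c ∈ O) → A.FG →
      IsFractionRing ↥A K → A.toSubring ≤ O.toSubring → ringKrullDim ↥A ≤ 2 →
      ∀ (m : ℕ) [IsNoetherianRing ↥(tower O A (m + 1))] [IsLocalRing ↥(tower O A (m + 1))]
        (x₀ : K) (hx₀T : x₀ ∈ tower O A (m + 1)), x₀ ∈ ca (tower O A m) → x₀ ≠ 0 →
        (∀ c ∈ ca (tower O A m), c * x₀⁻¹ ∈ O) →
        algebraMap ↥(tower O A (m + 1))
            (AdicCompletion (maximalIdeal ↥(tower O A (m + 1))) ↥(tower O A (m + 1))) ⟨x₀, hx₀T⟩ ∈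
          cohomologyAnnihilator (AdicCompletion (maximalIdeal ↥(tower O A (m + 1))) ↥(tower O A (m + 1)))) :
    PersistenceSurface := by
  intro p hp k K _ _ _ _ O A hk hA hfr hAO hdim ca' loc' chart' nrm' tower' m
  show ca (tower O A m) ⊆ ca (tower O A (m + 1))
  intro x hx
  by_cases hx0 : x = 0
  · rw [hx0]; exact zero_mem_ca _
  haveI := hfr
  haveI : IsNoetherianRing ↥(tower O A m) := stub_towerNoetherian k K O A hk hA hfr hAO m
  haveI : IsNoetherianRing ↥(tower O A (m + 1)) := stub_towerNoetherian k K O A hk hA hfr hAO (m + 1)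
  haveI : IsLocalRing ↥(tower O A (m + 1)) := (tower_isLocalRing_and_dominated O A hk hA hfr hAO (m + 1)).1
  have hTO : ∀ b ∈ tower O A m, b ∈ O :=
    fun b hb => (tn_tower_invariant O A hk hA hfr hAO m).2.1 (Subalgebra.mem_toSubring.mpr hb)
  obtain ⟨x₀, hx₀, hx₀0, hadm⟩ := di_exists_admissible O (tower O A m) hTO hx hx0
  have hle : tower O A m ≤ tower O A (m + 1) := fun y hy => by
    rw [tower_succ]
    exact SyzygyFlattening.self_le_locAt O _
      (SyzygyFlattening.self_le_nrm _ (Algebra.subset_adjoin (Or.inl hy)))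
  have hx₀T : x₀ ∈ tower O A (m + 1) := hle (ca_subset _ hx₀)
  have hmem := h p hp k K O A hk hA hfr hAO hdim m x₀ hx₀T hx₀ hx₀0 hadm
  have hx₀ca : x₀ ∈ ca (tower O A (m + 1)) :=
    mem_ca_of_algebraMap_mem_cohomologyAnnihilator_completion (tower O A (m + 1)) hx₀T hmem
  have hsplit : x = x * x₀⁻¹ * x₀ := by rw [inv_mul_cancel_right₀ hx₀0]
  rw [hsplit]
  exact mul_mem_ca _ (ca_mul_inv_mem_tower_succ O A m hx₀ hx₀0 hadm hx) hx₀ca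

/-- **The converse**: `PersistenceSurface` puts every admissible `x₀ ∈ ca(T_m)` into `ca(T_(m+1))`, hence its image into
`ca(T̂_(m+1))` — the stage `T_(m+1)` is normal (`d2rc_isIntegrallyClosed_tower_succ`), of Krull dimension `≤ 2`
(`ringKrullDim_tower_le_of_ringKrullDim_le`) and essentially of finite type (`tn_tower_invariant`).  So
`persistenceSurface_of_completedAdmissibleMembership` is an EXACT reformulation of the rung.
[cite: BahlekehHakimianSalarianTakahashi2015, Thm. 4.5] -/
theorem persistenceSurface_iff_completedAdmissibleMembership :
    PersistenceSurface ↔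
      ∀ p : ℕ, p.Prime → ∀ (k K : Type) [Field k] [CharP k p] [Field K] [Algebra k K]
        (O : ValuationSubring K) (A : Subalgebra k K), (∀ c : k, algebraMap k K c ∈ O) → A.FG →
        IsFractionRing ↥A K → A.toSubring ≤ O.toSubring → ringKrullDim ↥A ≤ 2 →
        ∀ (m : ℕ) [IsNoetherianRing ↥(tower O A (m + 1))] [IsLocalRing ↥(tower O A (m + 1))]
          (x₀ : K) (hx₀T : x₀ ∈ tower O A (m + 1)), x₀ ∈ ca (tower O A m) → x₀ ≠ 0 →
          (∀ c ∈ ca (tower O A m), c * x₀⁻¹ ∈ O) →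
          algebraMap ↥(tower O A (m + 1))
              (AdicCompletion (maximalIdeal ↥(tower O A (m + 1))) ↥(tower O A (m + 1))) ⟨x₀, hx₀T⟩ ∈
            cohomologyAnnihilator (AdicCompletion (maximalIdeal ↥(tower O A (m + 1))) ↥(tower O A (m + 1))) := by
  refine ⟨fun hP => ?_, persistenceSurface_of_completedAdmissibleMembership⟩
  intro p hp k K _ _ _ _ O A hk hA hfr hAO hdim m _ _ x₀ hx₀T hx₀ _ _
  haveI := hfr
  have hstep : ca (tower O A m) ⊆ ca (tower O A (m + 1)) := hP p hp k K O A hk hA hfr hAO hdim m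
  have hx₀ca : x₀ ∈ ca (tower O A (m + 1)) := hstep hx₀
  haveI : IsIntegrallyClosed ↥(tower O A (m + 1)) := d2rc_isIntegrallyClosed_tower_succ O A hk hA hfr hAO m
  have hT : Algebra.EssFiniteType k ↥(tower O A (m + 1)) := (tn_tower_invariant O A hk hA hfr hAO (m + 1)).2.2
  have hdimT : ringKrullDim ↥(tower O A (m + 1)) ≤ 2 := by
    have := ringKrullDim_tower_le_of_ringKrullDim_le O A hA hdim (m + 1)
    exact_mod_cast this
  exact algebraMap_mem_cohomologyAnnihilator_completion_of_mem_ca (tower O A (m + 1)) hT hdimT hx₀ca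

/-! ## First-step form (appended): one analytic membership at the FIRST step over all admissible data -/

/-- **`PersistenceSurface` ⟺ ONE COMPLETED MEMBERSHIP AT THE FIRST STEP**, over all admissible surface data: for every
admissible `(A, O)` with `dim A ≤ 2` and every admissible `x₀ ∈ ca(loc A)`, the image of `x₀` in the `𝔪`-adic completion
of `T₁ = loc O (nrm (loc A [ca / x₀]))` lies in `ca(T̂₁)`.  (`persistenceSurface_iff_firstStep` — hand
leafhand-res-homologicalconduct-4's FG re-basing, p798937 — composed with `persistenceSurface_iff_completedAdmissibleMembership`.)
This is the rung as ONE membership in ONE complete local ring per admissible datum.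
[cite: BahlekehHakimianSalarianTakahashi2015, Thm. 4.5; IyengarTakahashi2014, Def. 2.1] -/
theorem persistenceSurface_iff_firstCompletedAdmissibleMembership :
    PersistenceSurface ↔
      ∀ p : ℕ, p.Prime → ∀ (k K : Type) [Field k] [CharP k p] [Field K] [Algebra k K]
        (O : ValuationSubring K) (A : Subalgebra k K), (∀ c : k, algebraMap k K c ∈ O) → A.FG →
        IsFractionRing ↥A K → A.toSubring ≤ O.toSubring → ringKrullDim ↥A ≤ 2 →
        ∀ [IsNoetherianRing ↥(tower O A 1)] [IsLocalRing ↥(tower O A 1)]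
          (x₀ : K) (hx₀T : x₀ ∈ tower O A 1), x₀ ∈ ca (tower O A 0) → x₀ ≠ 0 →
          (∀ c ∈ ca (tower O A 0), c * x₀⁻¹ ∈ O) →
          algebraMap ↥(tower O A 1) (AdicCompletion (maximalIdeal ↥(tower O A 1)) ↥(tower O A 1)) ⟨x₀, hx₀T⟩ ∈
            cohomologyAnnihilator (AdicCompletion (maximalIdeal ↥(tower O A 1)) ↥(tower O A 1)) := by
  constructor
  · intro hP p hp k K _ _ _ _ O A hk hA hfr hAO hdim _ _ x₀ hx₀T hx₀ hx₀0 hadm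
    exact persistenceSurface_iff_completedAdmissibleMembership.mp hP p hp k K O A hk hA hfr hAO hdim 0 x₀ hx₀T
      hx₀ hx₀0 hadm
  · intro hF
    refine PersistenceSurfaceFirstStep.persistenceSurface_iff_firstStep.mpr ?_
    intro p hp k K _ _ _ _ O A hk hA hfr hAO hdim x hx
    by_cases hx0 : x = 0
    · rw [hx0]; exact zero_mem_ca _
    haveI := hfr
    haveI : IsNoetherianRing ↥(tower O A 0) := stub_towerNoetherian k K O A hk hA hfr hAO 0
    haveI : IsNoetherianRing ↥(tower O A 1) := stub_towerNoetherian k K O A hk hA hfr hAO 1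
    haveI : IsLocalRing ↥(tower O A 1) := (tower_isLocalRing_and_dominated O A hk hA hfr hAO 1).1
    have hTO : ∀ b ∈ tower O A 0, b ∈ O :=
      fun b hb => (tn_tower_invariant O A hk hA hfr hAO 0).2.1 (Subalgebra.mem_toSubring.mpr hb)
    obtain ⟨x₀, hx₀, hx₀0, hadm⟩ := di_exists_admissible O (tower O A 0) hTO hx hx0
    have hle : tower O A 0 ≤ tower O A 1 := fun y hy => by
      rw [show (1 : ℕ) = 0 + 1 from rfl, tower_succ]
      exact SyzygyFlattening.self_le_locAt O _
        (SyzygyFlattening.self_le_nrm _ (Algebra.subset_adjoin (Or.inl hy)))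
    have hx₀T : x₀ ∈ tower O A 1 := hle (ca_subset _ hx₀)
    have hmem := hF p hp k K O A hk hA hfr hAO hdim x₀ hx₀T hx₀ hx₀0 hadm
    have hx₀ca : x₀ ∈ ca (tower O A 1) :=
      mem_ca_of_algebraMap_mem_cohomologyAnnihilator_completion (tower O A 1) hx₀T hmem
    have hsplit : x = x * x₀⁻¹ * x₀ := by rw [inv_mul_cancel_right₀ hx₀0]
    rw [hsplit]
    exact mul_mem_ca _ (ca_mul_inv_mem_tower_succ O A 0 hx₀ hx₀0 hadm hx) hx₀ca

end Summit.ResolutionOfSingularities.ResolutionOfSingularities.Theorems.HomologicalConductor.PersistenceSurfaceCompletedAdmissibleMembership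

end
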